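import Mathlib.Data.ZMod.Basic
import Mathlib.NumberTheory.ArithmeticFunction.Misc
import Mathlib.Algebra.Order.BigOperators.Group.Finset
import Mathlib.Algebra.BigOperators.Intervals
import Mathlib.Algebra.BigOperators.Ring.Finset
import Mathlib.Algebra.BigOperators.Field
import Mathlib.Algebra.Field.GeomSum
import Mathlib.Order.Interval.Finset.Nat
import Mathlib.NumberTheory.Divisors
import Mathlib.Data.Nat.Log
import Mathlib.Data.Nat.Squarefree
import Mathlib.Analysis.SpecialFunctions.Pow.Real
import Mathlib.Analysis.SpecialFunctions.Pow.Asymptotics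
import Mathlib.Analysis.Complex.ExponentialBounds
import Literature.NumberTheory.Sieve.SieveFunctions
import Literature.NumberTheory.Sieve.DivisorBound
import HarnessLib

/-!
# The pair-product sequence: a sifted sequence of dimension `2` with level of distribution `1/2`

Topic `Literature/NumberTheory/Sieve`; companion of `SieveFramework.lean` / `LevelOfDistribution.lean`
(the `SieveSequence` layer: weights `a_n ≥ 0`, size `X(x)`, multiplicative density `g`,
`A_d(x) = g(d) X(x) + R_d(x)`, `HasLevelOfDistribution`) and of `SieveFunctions.lean` (the
`β`-sieve bounds). Everything in this file is PROVED; it is elementary (no analytic input).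

Purpose. The file constructs an explicit, unconditional test sequence of sieve dimension `κ = 2`
whose sifted sums can be evaluated by the prime number theorem: it is the input of the
refutation of the least-`β` form `SieveSequence.jurkat_richert_upper` of the `β`-sieve upper
bound (see the ERRATUM in `SieveFunctions.lean`; the refutation itself, which needs Mertens'
theorem and the prime number theorem, lives in a separate file). Test sequences of this kind —
numbers with a prescribed number of prime factors, counted with the multiplicative density
forced by the sieve axioms — are the classical device for showing that sieve bounds are or are
not attained (Selberg's extremal examples; Greaves, *Sieves in Number Theory*, §4.5; and §1.3.4,
(1.3.4.5)–(1.3.4.6), for densities given by counting residue classes, `ρ(d) = |𝓔_d|`, which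
is the mechanism used here for PAIRS of residue classes).

## The sequence

`a_n = #{(m₁, m₂) ∈ ℕ² : m₁ m₂ = n, 2^k ≤ m₁, m₂ < 2^{k+1} for some k}` (ordered pairs of
positive integers in a common dyadic block with product `n`). Then
`∑_{n ≤ x} a_n = #pairSet ⌊x⌋`, `pairSet N = {(m₁, m₂) : 1 ≤ mᵢ ≤ N, m₁ m₂ ≤ N, same block}`,
which we take as the size `X(x)` (so `R_1 = 0`), and
`A_d(x) = #{(m₁, m₂) ∈ pairSet ⌊x⌋ : d ∣ m₁ m₂}`. Since `d ∣ m₁ m₂` depends only on the residues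
of `m₁, m₂` modulo `d`, the natural density is `g(d) = ρ(d)/d²` with
`ρ(d) = #{(r₁, r₂) mod d : d ∣ r₁ r₂}`, a multiplicative function (Chinese remainder theorem) with
`ρ(p) = 2p − 1`, i.e. `g(p) = 2/p − 1/p² = 1 − (1 − 1/p)²`: dimension `2`, and
`V(z) = ∏_{p<z} (1 − g(p)) = ∏_{p<z} (1 − 1/p)²`.

## Contents (all proved)

* `PairProducts.residueCount` (`ρ`), `residueCount_prime`, `residueCount_mul` (CRT, via
  `ZMod.chineseRemainder`), `PairProducts.density` (`g`, an `ArithmeticFunction ℝ`),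
  `isMultiplicative_density`, `density_prime`; `residueCount_le_of_squarefree`
  (`ρ(d) ≤ d σ₀(d)` for squarefree `d`).
* `PairProducts.block k = [2^k, 2^{k+1})`, `pairSet N`, `blockPairs k N` (the part of `pairSet N`
  in `B_k × B_k`), `weight n = a_n`, the counting identity `sum_weight_eq_card`
  (`∑_{n ≤ N, Q n} a_n = #{(m₁,m₂) ∈ pairSet N : Q (m₁ m₂)}`) and the block decomposition
  `card_filter_pairSet`.
* Equidistribution in residue classes: the sampling lemma for antitone functions
  `abs_sum_filter_mod_sub_le` (`|∑_{m ≡ r} f − (1/d) ∑ f| ≤ 2 max f` on a run of consecutive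
  integers), `abs_card_blockPairs_mod_sub_le`
  (`|#{(m₁,m₂) ∈ blockPairs k N : mᵢ ≡ rᵢ (d)} − #blockPairs k N/d²| ≤ 4·2^k/d + 2`, using that the
  row and column counts under the hyperbola `m₁ m₂ ≤ N` are antitone), the residue decomposition
  `card_filter_dvd_eq_sum` and the remainder bound `abs_card_pairSet_dvd_sub_le`
  (`|A_d − ρ(d) X/d²| ≤ ρ(d) (8√N/d + 2(log₄ N + 1))`).
* `PairProducts.pairProducts : SieveSequence` and its dictionary (`pairProducts_sifted`,
  `pairProducts_congrSum`, `pairProducts_sifted_one`, `abs_remainder_le`,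
  `pairProducts_densityProduct : V(P(z)) = ∏_{p<z} (1 − 1/p)²`).
* Size: `size_ge` (`X(x) ≥ x/32` for `x ≥ 4`), `size_sixteen_pow_le` (`X(16^J) ≤ (16^J + 2)/3`).
* Sifted sum at `x = 16^J`, `z = 2^J` (`s = log √x / log z = 2`):
  `sum_sq_card_primes_le_sifted` (`S(𝒜, z; x) ≥ ∑_{J ≤ k < 2J} #{p ∈ B_k prime}²`: pairs of primes
  `≥ z` in a common block survive the sieve).
* `hasLevelOfDistribution_pairProducts : HasLevelOfDistribution pairProducts (1/2)`
  (`∑_{d ≤ x^{1/2−ε}, d squarefree} |R_d(x)| ≤ C x^{1−ε/2} (2 log x + 10) = o(X(x)/(log x)^B)`,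
  with the divisor bound `σ₀(d) ≤ C d^ε` of `DivisorBound.lean`).

## References

* G. Greaves, *Sieves in Number Theory*, Springer (2001), §1.3.4, (1.3.4.5)–(1.3.4.6) (sifting by
  residue classes: `ρ(d) = |𝓔_d|`), §1.3.5 (sifting density), §4.5 (extremal examples). [Greaves2001]
* H. Iwaniec, *Rosser's sieve*, Acta Arith. 36 (1980), 171–202 (the `β`-sieve bounds whose least-`β`
  transcription this sequence tests). [IwaniecActaArith1980]
-/

open Finset

noncomputable section

namespace Literature.NumberTheory.Sieve

namespace PairProducts

/-! ### The residue count `ρ(d)` -/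

/-- `residueCount d = ρ(d) = #{(r₁, r₂) ∈ [0, d)² : d ∣ r₁ r₂}`, the number of pairs of residues
modulo `d` whose product vanishes (`ρ(0) = 0`). [folklore] -/
def residueCount (d : ℕ) : ℕ :=
  #{x ∈ range d ×ˢ range d | d ∣ x.1 * x.2}

/-- `ρ(0) = 0`. [folklore] -/
theorem residueCount_zero : residueCount 0 = 0 := by
  simp [residueCount]

/-- `ρ(1) = 1`. [folklore] -/
theorem residueCount_one : residueCount 1 = 1 := by
  decide

/-- For a prime `p`, `ρ(p) = 2p − 1`: `p ∣ r₁ r₂` iff `r₁ = 0` or `r₂ = 0`. [folklore] -/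
theorem residueCount_prime {p : ℕ} (hp : p.Prime) : residueCount p = 2 * p - 1 := by
  have hp1 : 1 ≤ p := hp.one_le
  have key : {x ∈ range p ×ˢ range p | p ∣ x.1 * x.2} =
      ({0} ×ˢ range p) ∪ (range p ×ˢ {0}) := by
    ext ⟨a, b⟩
    simp only [Finset.mem_filter, Finset.mem_product, Finset.mem_range, Finset.mem_union,
      Finset.mem_singleton, hp.dvd_mul]
    constructor
    · rintro ⟨⟨ha, hb⟩, h | h⟩
      · exact Or.inl ⟨Nat.eq_zero_of_dvd_of_lt h ha, hb⟩
      · exact Or.inr ⟨ha, Nat.eq_zero_of_dvd_of_lt h hb⟩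
    · rintro (⟨rfl, hb⟩ | ⟨ha, rfl⟩)
      · exact ⟨⟨hp.pos, hb⟩, Or.inl (dvd_zero p)⟩
      · exact ⟨⟨ha, hp.pos⟩, Or.inr (dvd_zero p)⟩
  have hinter : ({0} ×ˢ range p) ∩ (range p ×ˢ {0}) = ({(0, 0)} : Finset (ℕ × ℕ)) := by
    ext ⟨a, b⟩
    simp only [Finset.mem_inter, Finset.mem_product, Finset.mem_singleton, Finset.mem_range,
      Prod.mk.injEq]
    omega
  have h := Finset.card_union_add_card_inter ({0} ×ˢ range p) (range p ×ˢ ({0} : Finset ℕ))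
  rw [hinter, Finset.card_singleton, Finset.card_product, Finset.card_product,
    Finset.card_singleton, Finset.card_range, one_mul, mul_one] at h
  rw [residueCount, key]
  omega

/-- For `d ≥ 1`, `ρ(d)` is the number of pairs in `(ℤ/d)²` with vanishing product. [folklore] -/
theorem residueCount_eq_card (d : ℕ) [NeZero d] :
    residueCount d = Fintype.card {x : ZMod d × ZMod d // x.1 * x.2 = 0} := by
  classical
  rw [residueCount, Fintype.card_subtype]
  -- compare via the bijection `(r₁, r₂) ↦ (↑r₁, ↑r₂)`
  refine Finset.card_bij (fun x _ => ((x.1 : ZMod d), (x.2 : ZMod d))) ?_ ?_ ?_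
  · intro x hx
    rw [Finset.mem_filter, Finset.mem_product, Finset.mem_range, Finset.mem_range] at hx
    rw [Finset.mem_filter]
    refine ⟨Finset.mem_univ _, ?_⟩
    rw [← Nat.cast_mul, ZMod.natCast_eq_zero_iff]
    exact hx.2
  · intro x hx y hy hxy
    rw [Finset.mem_filter, Finset.mem_product, Finset.mem_range, Finset.mem_range] at hx hy
    simp only [Prod.mk.injEq] at hxy
    have h1 := congrArg ZMod.val hxy.1
    have h2 := congrArg ZMod.val hxy.2
    rw [ZMod.val_natCast, ZMod.val_natCast, Nat.mod_eq_of_lt hx.1.1, Nat.mod_eq_of_lt hy.1.1]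
      at h1
    rw [ZMod.val_natCast, ZMod.val_natCast, Nat.mod_eq_of_lt hx.1.2, Nat.mod_eq_of_lt hy.1.2]
      at h2
    exact Prod.ext h1 h2
  · intro y hy
    rw [Finset.mem_filter] at hy
    refine ⟨(y.1.val, y.2.val), ?_, ?_⟩
    · rw [Finset.mem_filter, Finset.mem_product, Finset.mem_range, Finset.mem_range]
      refine ⟨⟨ZMod.val_lt _, ZMod.val_lt _⟩, ?_⟩
      rw [← ZMod.natCast_eq_zero_iff, Nat.cast_mul, ZMod.natCast_zmod_val,
        ZMod.natCast_zmod_val]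
      exact hy.2
    · simp

/-- `ρ` is multiplicative on coprime arguments (Chinese remainder theorem). [folklore] -/
theorem residueCount_mul {m n : ℕ} (h : m.Coprime n) :
    residueCount (m * n) = residueCount m * residueCount n := by
  rcases Nat.eq_zero_or_pos m with rfl | hm
  · simp [residueCount_zero]
  rcases Nat.eq_zero_or_pos n with rfl | hn
  · simp [residueCount_zero]
  haveI : NeZero m := ⟨hm.ne'⟩
  haveI : NeZero n := ⟨hn.ne'⟩
  haveI : NeZero (m * n) := ⟨(Nat.mul_pos hm hn).ne'⟩
  rw [residueCount_eq_card, residueCount_eq_card, residueCount_eq_card, ← Fintype.card_prod]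
  let e := ZMod.chineseRemainder h
  let E : ZMod (m * n) × ZMod (m * n) ≃ (ZMod m × ZMod m) × (ZMod n × ZMod n) :=
    (e.toEquiv.prodCongr e.toEquiv).trans (Equiv.prodProdProdComm _ _ _ _)
  refine Fintype.card_congr ((Equiv.subtypeEquiv E ?_).trans (Equiv.subtypeProdEquivProd))
  intro x
  change x.1 * x.2 = 0 ↔ (e x.1).1 * (e x.2).1 = 0 ∧ (e x.1).2 * (e x.2).2 = 0
  rw [← Prod.fst_mul, ← Prod.snd_mul, ← map_mul, ← Prod.mk_eq_zero, Prod.mk.eta,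
    EmbeddingLike.map_eq_zero_iff]

/-! ### The density `g(d) = ρ(d)/d²` -/

/-- The density of the pair-product sequence: `g(d) = ρ(d)/d²`, the proportion of pairs of residues
modulo `d` with product divisible by `d` (`g(0) = 0`). [folklore] -/
noncomputable def density : ArithmeticFunction ℝ :=
  ⟨fun d => (residueCount d : ℝ) / (d : ℝ) ^ 2, by simp [residueCount_zero]⟩

/-- `g(d) = ρ(d)/d²` (unfolding). [folklore] -/
theorem density_apply (d : ℕ) : density d = (residueCount d : ℝ) / (d : ℝ) ^ 2 := rfl

/-- `g` is multiplicative. [folklore] -/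
theorem isMultiplicative_density : density.IsMultiplicative := by
  refine ⟨by simp [density_apply, residueCount_one], fun {m n} hmn => ?_⟩
  simp only [density_apply, residueCount_mul hmn, Nat.cast_mul]
  rw [mul_pow, div_mul_div_comm]

/-- `g(p) = (2p − 1)/p² = 2/p − 1/p² = 1 − (1 − 1/p)²` for a prime `p`. [folklore] -/
theorem density_prime {p : ℕ} (hp : p.Prime) : density p = 1 - (1 - (p : ℝ)⁻¹) ^ 2 := by
  rw [density_apply, residueCount_prime hp]
  have hp1 : 1 ≤ 2 * p := by linarith [hp.one_le]
  have hp0 : (p : ℝ) ≠ 0 := by exact_mod_cast hp.ne_zero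
  rw [Nat.cast_sub hp1]
  push_cast
  field_simp
  ring

/-! ### Dyadic blocks and the pair sets -/

/-- The dyadic block `B_k = [2^k, 2^{k+1})`. [folklore] -/
def block (k : ℕ) : Finset ℕ := Finset.Ico (2 ^ k) (2 ^ (k + 1))

/-- `m ∈ B_k ↔ 2^k ≤ m < 2^{k+1}`. [folklore] -/
theorem mem_block {k m : ℕ} : m ∈ block k ↔ 2 ^ k ≤ m ∧ m < 2 ^ (k + 1) := by
  rw [block, Finset.mem_Ico]

/-- `m ∈ B_k ↔ m ≠ 0 ∧ log₂ m = k`. [folklore] -/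
theorem mem_block_iff_log {k m : ℕ} : m ∈ block k ↔ m ≠ 0 ∧ Nat.log 2 m = k := by
  rw [mem_block]
  constructor
  · rintro ⟨h1, h2⟩
    have hm : m ≠ 0 := by have := Nat.one_le_two_pow (n := k); omega
    exact ⟨hm, (Nat.log_eq_iff (Or.inr ⟨one_lt_two, hm⟩)).mpr ⟨h1, h2⟩⟩
  · rintro ⟨hm, rfl⟩
    exact (Nat.log_eq_iff (Or.inr ⟨one_lt_two, hm⟩)).mp rfl

/-- `#B_k = 2^k`. [folklore] -/
theorem card_block (k : ℕ) : #(block k) = 2 ^ k := by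
  rw [block, Nat.card_Ico, pow_succ]; omega

/-- Elements of a block are positive. [folklore] -/
theorem one_le_of_mem_block {k m : ℕ} (h : m ∈ block k) : 1 ≤ m :=
  Nat.one_le_iff_ne_zero.mpr (mem_block_iff_log.mp h).1

/-- `pairSet N`: the pairs `(m₁, m₂)` with `1 ≤ mᵢ ≤ N`, `m₁ m₂ ≤ N`, in a common dyadic block.
[folklore] -/
def pairSet (N : ℕ) : Finset (ℕ × ℕ) :=
  {x ∈ Icc 1 N ×ˢ Icc 1 N | x.1 * x.2 ≤ N ∧ Nat.log 2 x.1 = Nat.log 2 x.2}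

/-- `blockPairs k N`: the pairs of the block `B_k × B_k` with `m₁ m₂ ≤ N`. [folklore] -/
def blockPairs (k N : ℕ) : Finset (ℕ × ℕ) :=
  {x ∈ block k ×ˢ block k | x.1 * x.2 ≤ N}

/-- Membership in `pairSet N`: `1 ≤ mᵢ ≤ N`, `m₁ m₂ ≤ N`, `log₂ m₁ = log₂ m₂`. [folklore] -/
theorem mem_pairSet {N : ℕ} {x : ℕ × ℕ} :
    x ∈ pairSet N ↔ (1 ≤ x.1 ∧ x.1 ≤ N) ∧ (1 ≤ x.2 ∧ x.2 ≤ N) ∧ x.1 * x.2 ≤ N ∧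
      Nat.log 2 x.1 = Nat.log 2 x.2 := by
  simp only [pairSet, Finset.mem_filter, Finset.mem_product, Finset.mem_Icc, and_assoc]

/-- Membership in `blockPairs k N`: `m₁, m₂ ∈ B_k`, `m₁ m₂ ≤ N`. [folklore] -/
theorem mem_blockPairs {k N : ℕ} {x : ℕ × ℕ} :
    x ∈ blockPairs k N ↔ x.1 ∈ block k ∧ x.2 ∈ block k ∧ x.1 * x.2 ≤ N := by
  simp only [blockPairs, Finset.mem_filter, Finset.mem_product, and_assoc]

/-- A pair of `pairSet N` with first coordinate in `B_k` lies in `blockPairs k N`, and conversely.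
[folklore] -/
theorem mem_pairSet_iff {N : ℕ} {x : ℕ × ℕ} :
    x ∈ pairSet N ↔ ∃ k, x ∈ blockPairs k N := by
  rw [mem_pairSet]
  constructor
  · rintro ⟨⟨h1, -⟩, ⟨h2, -⟩, h3, h4⟩
    refine ⟨Nat.log 2 x.1, mem_blockPairs.mpr ⟨?_, ?_, h3⟩⟩
    · exact mem_block_iff_log.mpr ⟨by omega, rfl⟩
    · exact mem_block_iff_log.mpr ⟨by omega, h4.symm⟩
  · rintro ⟨k, hx⟩
    rw [mem_blockPairs] at hx
    obtain ⟨h1, h2, h3⟩ := hx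
    have h1' := one_le_of_mem_block h1
    have h2' := one_le_of_mem_block h2
    refine ⟨⟨h1', le_trans (Nat.le_mul_of_pos_right _ h2') h3⟩,
      ⟨h2', le_trans (Nat.le_mul_of_pos_left _ h1') h3⟩, h3, ?_⟩
    rw [(mem_block_iff_log.mp h1).2, (mem_block_iff_log.mp h2).2]

/-- **Block decomposition**: a count over `pairSet N` is the sum over the blocks `k ≤ log₂ N` of the
counts over `blockPairs k N`. [folklore] -/
theorem card_filter_pairSet (N : ℕ) (R : ℕ × ℕ → Prop) [DecidablePred R] :
    #{x ∈ pairSet N | R x} = ∑ k ∈ range (Nat.log 2 N + 1), #{x ∈ blockPairs k N | R x} := by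
  rw [Finset.card_eq_sum_card_fiberwise (f := fun x : ℕ × ℕ => Nat.log 2 x.1)
    (t := range (Nat.log 2 N + 1))]
  · refine Finset.sum_congr rfl fun k _ => ?_
    congr 1
    ext x
    simp only [Finset.mem_filter]
    constructor
    · rintro ⟨⟨hx, hR⟩, hk⟩
      obtain ⟨k', hk'⟩ := mem_pairSet_iff.mp hx
      have : k' = k := by
        rw [← hk]; exact ((mem_block_iff_log.mp (mem_blockPairs.mp hk').1).2).symm
      subst this
      exact ⟨hk', hR⟩
    · rintro ⟨hx, hR⟩
      exact ⟨⟨mem_pairSet_iff.mpr ⟨k, hx⟩, hR⟩, (mem_block_iff_log.mp (mem_blockPairs.mp hx).1).2⟩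
  · intro x hx
    rw [Finset.mem_coe, Finset.mem_filter] at hx
    obtain ⟨⟨-, h1N⟩, -⟩ := mem_pairSet.mp hx.1
    exact Finset.mem_coe.mpr (Finset.mem_range.mpr (Nat.lt_succ_of_le (Nat.log_mono_right h1N)))

/-- Blocks beyond `√N` carry no pairs: if `N < 4^k` then `blockPairs k N = ∅`. [folklore] -/
theorem blockPairs_eq_empty {k N : ℕ} (h : N < 4 ^ k) : blockPairs k N = ∅ := by
  refine Finset.eq_empty_of_forall_notMem fun x hx => ?_
  obtain ⟨h1, h2, h3⟩ := mem_blockPairs.mp hx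
  have h1' := (mem_block.mp h1).1
  have h2' := (mem_block.mp h2).1
  have : 4 ^ k ≤ x.1 * x.2 := by
    rw [show (4 : ℕ) ^ k = 2 ^ k * 2 ^ k by rw [← mul_pow]; norm_num]; exact Nat.mul_le_mul h1' h2'
  omega

/-- `#blockPairs k N ≤ 4^k`. [folklore] -/
theorem card_blockPairs_le (k N : ℕ) : #(blockPairs k N) ≤ 4 ^ k := by
  calc #(blockPairs k N) ≤ #(block k ×ˢ block k) := Finset.card_filter_le _ _
    _ = 4 ^ k := by rw [Finset.card_product, card_block, ← mul_pow]; norm_num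

/-- A full block: if `4^{k+1} ≤ N` then `blockPairs k N = B_k × B_k`. [folklore] -/
theorem blockPairs_eq_product {k N : ℕ} (h : 4 ^ (k + 1) ≤ N) :
    blockPairs k N = block k ×ˢ block k := by
  refine Finset.filter_true_of_mem fun x hx => ?_
  rw [Finset.mem_product] at hx
  have h1 := (mem_block.mp hx.1).2
  have h2 := (mem_block.mp hx.2).2
  have : x.1 * x.2 < 4 ^ (k + 1) := by
    rw [show (4 : ℕ) ^ (k + 1) = 2 ^ (k + 1) * 2 ^ (k + 1) by rw [← mul_pow]; norm_num]
    exact Nat.mul_lt_mul'' h1 h2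
  omega

/-! ### The weights and the counting identity -/

/-- `weight n = a_n = #{(m₁, m₂) : m₁ m₂ = n, m₁, m₂ in a common dyadic block}`. [folklore] -/
def weight (n : ℕ) : ℕ :=
  #{x ∈ Nat.divisorsAntidiagonal n | Nat.log 2 x.1 = Nat.log 2 x.2}

/-- **Counting identity**: `∑_{n ≤ N, Q(n)} a_n = #{(m₁, m₂) ∈ pairSet N : Q(m₁ m₂)}`. [folklore] -/
theorem sum_weight_eq_card (N : ℕ) (Q : ℕ → Prop) [DecidablePred Q] :
    ∑ n ∈ (Ioc 0 N).filter Q, (weight n : ℝ) = #{x ∈ pairSet N | Q (x.1 * x.2)} := by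
  rw [Finset.card_eq_sum_card_fiberwise (f := fun x : ℕ × ℕ => x.1 * x.2)
    (t := (Ioc 0 N).filter Q)]
  · push_cast
    refine Finset.sum_congr rfl fun n hn => ?_
    rw [Finset.mem_filter, Finset.mem_Ioc] at hn
    unfold weight
    congr 2
    ext x
    simp only [Finset.mem_filter, Nat.mem_divisorsAntidiagonal, mem_pairSet]
    constructor
    · rintro ⟨⟨hx, hn0⟩, hlog⟩
      subst hx
      have h1 : 1 ≤ x.1 := Nat.one_le_iff_ne_zero.mpr fun h => hn0 (by simp [h])
      have h2 : 1 ≤ x.2 := Nat.one_le_iff_ne_zero.mpr fun h => hn0 (by simp [h])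
      exact ⟨⟨⟨⟨h1, le_trans (Nat.le_mul_of_pos_right _ h2) hn.1.2⟩,
        ⟨h2, le_trans (Nat.le_mul_of_pos_left _ h1) hn.1.2⟩, hn.1.2, hlog⟩, hn.2⟩, rfl⟩
    · rintro ⟨⟨⟨-, -, -, hlog⟩, -⟩, hx⟩
      exact ⟨⟨hx, by omega⟩, hlog⟩
  · intro x hx
    rw [Finset.mem_coe, Finset.mem_filter] at hx
    rw [Finset.mem_coe, Finset.mem_filter]
    obtain ⟨⟨h1, -⟩, ⟨h2, -⟩, h3, -⟩ := mem_pairSet.mp hx.1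
    exact ⟨Finset.mem_Ioc.mpr ⟨Nat.mul_pos h1 h2, h3⟩, hx.2⟩

/-! ### Residue classes in runs of consecutive integers -/

/-- In `d` consecutive integers exactly one lies in a given residue class `r < d`. [folklore] -/
theorem existsUnique_mod_eq (b d r : ℕ) (hr : r < d) :
    ∃ h ∈ Ico b (b + d), h % d = r ∧ ∀ m ∈ Ico b (b + d), m % d = r → m = h := by
  have hmem : r ∈ (Ico b (b + d)).image (· % d) := by
    rw [Nat.image_Ico_mod]; exact mem_range.mpr hr
  obtain ⟨h, hh, hhr⟩ := mem_image.mp hmem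
  refine ⟨h, hh, hhr, fun m hm hmr => ?_⟩
  exact Nat.mod_injOn_Ico b d (mem_coe.mpr hm) (mem_coe.mpr hh) (hmr.trans hhr.symm)

/-- The sum of `f` over one residue class in a run of `d` consecutive integers is a single value
`f(h)`, `b ≤ h < b + d`. [folklore] -/
theorem sum_filter_mod_Ico_eq (f : ℕ → ℝ) (b d r : ℕ) (hr : r < d) :
    ∃ h ∈ Ico b (b + d), ∑ m ∈ (Ico b (b + d)).filter (fun m => m % d = r), f m = f h := by
  obtain ⟨h, hh, hhr, huniq⟩ := existsUnique_mod_eq b d r hr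
  refine ⟨h, hh, ?_⟩
  have : (Ico b (b + d)).filter (fun m => m % d = r) = {h} := by
    ext m
    simp only [mem_filter, mem_singleton]
    exact ⟨fun hm => huniq m hm.1 hm.2, fun hm => hm ▸ ⟨hh, hhr⟩⟩
  rw [this, sum_singleton]

/-- At most one element of a residue class in fewer than `d` consecutive integers... precisely, in a
run of length `e ≤ d`. [folklore] -/
theorem card_filter_mod_Ico_le_one (b d e r : ℕ) (he : e ≤ d) (hr : r < d) :
    #((Ico b (b + e)).filter (fun m => m % d = r)) ≤ 1 := by
  obtain ⟨h, -, -, huniq⟩ := existsUnique_mod_eq b d r hr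
  refine card_le_one.mpr fun x hx y hy => ?_
  rw [mem_filter, mem_Ico] at hx hy
  have hx' : x ∈ Ico b (b + d) := mem_Ico.mpr ⟨hx.1.1, by omega⟩
  have hy' : y ∈ Ico b (b + d) := mem_Ico.mpr ⟨hy.1.1, by omega⟩
  rw [huniq x hx' hx.2, huniq y hy' hy.2]

/-- In a run of `q d` consecutive integers each residue class has exactly `q` elements. [folklore] -/
theorem card_filter_mod_Ico_mul (b d q r : ℕ) (hr : r < d) :
    #((Ico b (b + q * d)).filter (fun m => m % d = r)) = q := by
  induction q with
  | zero => simp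
  | succ q ih =>
    rw [Nat.succ_mul, ← add_assoc, ← Ico_union_Ico_eq_Ico (b := b + q * d) (by omega) (by omega),
      filter_union, card_union_of_disjoint, ih]
    · obtain ⟨h, hh, hhr, huniq⟩ := existsUnique_mod_eq (b + q * d) d r hr
      have : (Ico (b + q * d) (b + q * d + d)).filter (fun m => m % d = r) = {h} := by
        ext m
        simp only [mem_filter, mem_singleton]
        exact ⟨fun hm => huniq m hm.1 hm.2, fun hm => hm ▸ ⟨hh, hhr⟩⟩
      rw [this, card_singleton]
    · exact disjoint_filter_filter (Ico_disjoint_Ico_consecutive _ _ _)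

/-- **Residue classes in an interval**: `#{m ∈ [b, b + L) : m ≡ r (d)} ≤ L/d + 1`. [folklore] -/
theorem card_filter_mod_Ico_le {d : ℕ} (hd : 0 < d) (b L r : ℕ) :
    (#((Ico b (b + L)).filter (fun m => m % d = r)) : ℝ) ≤ L / d + 1 := by
  by_cases hr : r < d
  swap
  · have : (Ico b (b + L)).filter (fun m => m % d = r) = ∅ :=
      filter_eq_empty_iff.mpr fun m _ h => hr (h ▸ Nat.mod_lt m hd)
    rw [this, card_empty]; push_cast; positivity
  set q := L / d
  set e := L % d
  have hL : L = q * d + e := by rw [Nat.div_add_mod' L d]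
  have he : e < d := Nat.mod_lt L hd
  rw [hL, ← add_assoc, ← Ico_union_Ico_eq_Ico (b := b + q * d) (by omega) (by omega),
    filter_union]
  have h1 := card_filter_mod_Ico_mul b d q r hr
  have h2 := card_filter_mod_Ico_le_one (b + q * d) d e r he.le hr
  have hq : (q : ℝ) ≤ (q * d + e : ℕ) / d := by
    rw [le_div_iff₀ (by exact_mod_cast hd)]; push_cast; nlinarith [he.le, (Nat.cast_nonneg e : (0:ℝ) ≤ e)]
  calc (#((Ico b (b + q * d)).filter (fun m => m % d = r) ∪
          (Ico (b + q * d) (b + q * d + e)).filter (fun m => m % d = r)) : ℝ)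
      ≤ #((Ico b (b + q * d)).filter (fun m => m % d = r)) +
          #((Ico (b + q * d) (b + q * d + e)).filter (fun m => m % d = r)) := by
        exact_mod_cast card_union_le _ _
    _ ≤ q + 1 := by rw [h1]; exact_mod_cast Nat.add_le_add_left h2 q
    _ ≤ _ := by linarith

/-! ### The sampling lemma for antitone functions -/

/-- Core of the sampling lemma, on `q` full periods: for `f` antitone,
`|∑_{m ∈ [b, b+qd), m ≡ r} f(m) − (1/d) ∑_{m ∈ [b, b+qd)} f(m)| ≤ f(b) − f(b + qd)`. [folklore] -/
theorem abs_sum_filter_mod_sub_le_aux {f : ℕ → ℝ} (hf : Antitone f) {d : ℕ} (hd : 0 < d) (b r : ℕ)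
    (hr : r < d) (q : ℕ) :
    |∑ m ∈ (Ico b (b + q * d)).filter (fun m => m % d = r), f m -
        (∑ m ∈ Ico b (b + q * d), f m) / d| ≤ f b - f (b + q * d) := by
  have hd' : (0 : ℝ) < d := by exact_mod_cast hd
  induction q with
  | zero => simp
  | succ q ih =>
    have hsplit : Ico b (b + (q + 1) * d) = Ico b (b + q * d) ∪ Ico (b + q * d) (b + q * d + d) := by
      rw [Nat.succ_mul, ← add_assoc, Ico_union_Ico_eq_Ico (by omega) (by omega)]
    have hdisj : Disjoint (Ico b (b + q * d)) (Ico (b + q * d) (b + q * d + d)) :=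
      Ico_disjoint_Ico_consecutive _ _ _
    rw [hsplit, filter_union, sum_union (disjoint_filter_filter hdisj), sum_union hdisj]
    obtain ⟨h, hh, hsum⟩ := sum_filter_mod_Ico_eq f (b + q * d) d r hr
    rw [hsum]
    rw [mem_Ico] at hh
    -- bounds on the new chunk
    have hfh1 : f h ≤ f (b + q * d) := hf hh.1
    have hfh2 : f (b + q * d + d) ≤ f h := hf (by omega)
    have hchunk1 : ∑ m ∈ Ico (b + q * d) (b + q * d + d), f m ≤ d * f (b + q * d) := by
      have := Finset.sum_le_card_nsmul (Ico (b + q * d) (b + q * d + d)) f (f (b + q * d))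
        (fun m hm => hf (mem_Ico.mp hm).1)
      rwa [Nat.card_Ico, show b + q * d + d - (b + q * d) = d by omega, nsmul_eq_mul] at this
    have hchunk2 : (d : ℝ) * f (b + q * d + d) ≤ ∑ m ∈ Ico (b + q * d) (b + q * d + d), f m := by
      have := Finset.card_nsmul_le_sum (Ico (b + q * d) (b + q * d + d)) f (f (b + q * d + d))
        (fun m hm => hf (by have := (mem_Ico.mp hm).2; omega))
      rwa [Nat.card_Ico, show b + q * d + d - (b + q * d) = d by omega, nsmul_eq_mul] at this
    have heq : b + (q + 1) * d = b + q * d + d := by ring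
    rw [heq]
    -- combine with the induction hypothesis
    have key : |f h - (∑ m ∈ Ico (b + q * d) (b + q * d + d), f m) / d| ≤
        f (b + q * d) - f (b + q * d + d) := by
      rw [abs_le]
      constructor
      · have : (∑ m ∈ Ico (b + q * d) (b + q * d + d), f m) / d ≤ f (b + q * d) := by
          rw [div_le_iff₀ hd']; linarith
        linarith
      · have : f (b + q * d + d) ≤ (∑ m ∈ Ico (b + q * d) (b + q * d + d), f m) / d := by
          rw [le_div_iff₀ hd']; linarith
        linarith
    calc |∑ m ∈ (Ico b (b + q * d)).filter (fun m => m % d = r), f m + f h -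
            (∑ m ∈ Ico b (b + q * d), f m + ∑ m ∈ Ico (b + q * d) (b + q * d + d), f m) / d|
        = |(∑ m ∈ (Ico b (b + q * d)).filter (fun m => m % d = r), f m -
              (∑ m ∈ Ico b (b + q * d), f m) / d) +
            (f h - (∑ m ∈ Ico (b + q * d) (b + q * d + d), f m) / d)| := by
          congr 1; rw [add_div]; ring
      _ ≤ |∑ m ∈ (Ico b (b + q * d)).filter (fun m => m % d = r), f m -
              (∑ m ∈ Ico b (b + q * d), f m) / d| +
            |f h - (∑ m ∈ Ico (b + q * d) (b + q * d + d), f m) / d| := abs_add_le _ _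
      _ ≤ (f b - f (b + q * d)) + (f (b + q * d) - f (b + q * d + d)) := add_le_add ih key
      _ = f b - f (b + q * d + d) := by ring

/-- **Sampling lemma**: for `f : ℕ → ℝ` antitone with `0 ≤ f ≤ M`, every `d ≥ 1`, residue
`r < d` and run `[b, b + L)`,
`|∑_{m ∈ [b, b+L), m ≡ r (d)} f(m) − (1/d) ∑_{m ∈ [b, b+L)} f(m)| ≤ 2M`. [folklore] -/
theorem abs_sum_filter_mod_sub_le {f : ℕ → ℝ} (hf : Antitone f) {M : ℝ} (hf0 : ∀ m, 0 ≤ f m)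
    (hfM : ∀ m, f m ≤ M) {d : ℕ} (hd : 0 < d) (b L : ℕ) {r : ℕ} (hr : r < d) :
    |∑ m ∈ (Ico b (b + L)).filter (fun m => m % d = r), f m -
        (∑ m ∈ Ico b (b + L), f m) / d| ≤ 2 * M := by
  have hd' : (0 : ℝ) < d := by exact_mod_cast hd
  have hM : 0 ≤ M := (hf0 0).trans (hfM 0)
  set q := L / d
  set e := L % d
  have hL : L = q * d + e := by rw [Nat.div_add_mod' L d]
  have he : e < d := Nat.mod_lt L hd
  have hsplit : Ico b (b + L) = Ico b (b + q * d) ∪ Ico (b + q * d) (b + q * d + e) := by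
    rw [hL, ← add_assoc, Ico_union_Ico_eq_Ico (by omega) (by omega)]
  have hdisj : Disjoint (Ico b (b + q * d)) (Ico (b + q * d) (b + q * d + e)) :=
    Ico_disjoint_Ico_consecutive _ _ _
  rw [hsplit, filter_union, sum_union (disjoint_filter_filter hdisj), sum_union hdisj]
  set S1 := ∑ m ∈ (Ico b (b + q * d)).filter (fun m => m % d = r), f m
  set S2 := ∑ m ∈ (Ico (b + q * d) (b + q * d + e)).filter (fun m => m % d = r), f m
  set T1 := ∑ m ∈ Ico b (b + q * d), f m
  set T2 := ∑ m ∈ Ico (b + q * d) (b + q * d + e), f m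
  have h1 : |S1 - T1 / d| ≤ M := by
    refine (abs_sum_filter_mod_sub_le_aux hf hd b r hr q).trans ?_
    linarith [hfM b, hf0 (b + q * d)]
  -- the tail: at most one sampled term, and fewer than `d` terms in all
  have hS2 : 0 ≤ S2 ∧ S2 ≤ M := by
    refine ⟨sum_nonneg fun m _ => hf0 m, ?_⟩
    have hcard := card_filter_mod_Ico_le_one (b + q * d) d e r he.le hr
    calc S2 ≤ ∑ m ∈ (Ico (b + q * d) (b + q * d + e)).filter (fun m => m % d = r), M :=
          sum_le_sum fun m _ => hfM m
      _ = #((Ico (b + q * d) (b + q * d + e)).filter (fun m => m % d = r)) * M := by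
          rw [sum_const, nsmul_eq_mul]
      _ ≤ 1 * M := by gcongr; exact_mod_cast hcard
      _ = M := one_mul M
  have hT2 : 0 ≤ T2 / d ∧ T2 / d ≤ M := by
    refine ⟨div_nonneg (sum_nonneg fun m _ => hf0 m) hd'.le, ?_⟩
    rw [div_le_iff₀ hd']
    calc T2 ≤ ∑ m ∈ Ico (b + q * d) (b + q * d + e), M := sum_le_sum fun m _ => hfM m
      _ = e * M := by
          rw [sum_const, Nat.card_Ico, nsmul_eq_mul, show b + q * d + e - (b + q * d) = e by omega]
      _ ≤ M * d := by rw [mul_comm]; gcongr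
  have h2 : |S2 - T2 / d| ≤ M := by
    rw [abs_le]; constructor <;> linarith [hS2.1, hS2.2, hT2.1, hT2.2]
  calc |S1 + S2 - (T1 + T2) / d| = |(S1 - T1 / d) + (S2 - T2 / d)| := by
        congr 1; rw [add_div]; ring
    _ ≤ |S1 - T1 / d| + |S2 - T2 / d| := abs_add_le _ _
    _ ≤ M + M := add_le_add h1 h2
    _ = 2 * M := by ring


/-! ### Equidistribution of the block pairs in residue classes -/

/-- A count over a product set as an iterated count (rows). [folklore] -/
theorem card_filter_product_eq_sum (s t : Finset ℕ) (P : ℕ × ℕ → Prop) [DecidablePred P] :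
    #{x ∈ s ×ˢ t | P x} = ∑ a ∈ s, #{b ∈ t | P (a, b)} := by
  rw [card_filter, sum_product]
  refine sum_congr rfl fun a _ => ?_
  rw [card_filter]

/-- A count over a product set as an iterated count (columns). [folklore] -/
theorem card_filter_product_eq_sum' (s t : Finset ℕ) (P : ℕ × ℕ → Prop) [DecidablePred P] :
    #{x ∈ s ×ˢ t | P x} = ∑ b ∈ t, #{a ∈ s | P (a, b)} := by
  rw [card_filter, sum_product_right]
  refine sum_congr rfl fun b _ => ?_
  rw [card_filter]

/-- `B_k = [2^k, 2^k + 2^k)` (a run of `2^k` consecutive integers). [folklore] -/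
theorem block_eq_Ico (k : ℕ) : block k = Ico (2 ^ k) (2 ^ k + 2 ^ k) := by
  rw [block, pow_succ, mul_two]

/-- **Equidistribution of `blockPairs k N` in residue classes**: for `d ≥ 1` and residues
`r₁, r₂ < d`, `|#{(m₁, m₂) ∈ blockPairs k N : mᵢ ≡ rᵢ (d)} − #blockPairs k N / d²| ≤ 4 · 2^k/d + 2`
(two applications of the sampling lemma: the row counts `m₁ ↦ #{m₂ : m₁ m₂ ≤ N, m₂ ≡ r₂}` and the
column counts `m₂ ↦ #{m₁ : m₁ m₂ ≤ N}` are antitone). [folklore] -/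
theorem abs_card_blockPairs_mod_sub_le (k N : ℕ) {d : ℕ} (hd : 0 < d) {r₁ r₂ : ℕ} (hr₁ : r₁ < d)
    (hr₂ : r₂ < d) :
    |(#{x ∈ blockPairs k N | x.1 % d = r₁ ∧ x.2 % d = r₂} : ℝ) - #(blockPairs k N) / (d : ℝ) ^ 2| ≤
      4 * 2 ^ k / d + 2 := by
  have hd' : (0 : ℝ) < d := by exact_mod_cast hd
  set B := block k with hB
  have hBI : B = Ico (2 ^ k) (2 ^ k + 2 ^ k) := block_eq_Ico k
  -- row counts
  set f : ℕ → ℝ := fun m₁ => #{m₂ ∈ B | m₁ * m₂ ≤ N ∧ m₂ % d = r₂} with hf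
  have hf_anti : Antitone f := by
    intro a b hab
    simp only [hf]
    exact_mod_cast card_le_card (fun m hm => by
      rw [mem_filter] at hm ⊢
      exact ⟨hm.1, le_trans (Nat.mul_le_mul_right _ hab) hm.2.1, hm.2.2⟩)
  have hf0 : ∀ m, 0 ≤ f m := fun m => by positivity
  have hfM : ∀ m, f m ≤ 2 ^ k / d + 1 := by
    intro m
    calc f m ≤ #{m₂ ∈ B | m₂ % d = r₂} := by
          simp only [hf]
          exact_mod_cast card_le_card (fun x hx => by
            rw [mem_filter] at hx ⊢; exact ⟨hx.1, hx.2.2⟩)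
      _ ≤ (2 ^ k : ℕ) / d + 1 := by rw [hBI]; exact card_filter_mod_Ico_le hd _ _ _
      _ = 2 ^ k / d + 1 := by push_cast; ring
  -- column counts
  set h : ℕ → ℝ := fun m₂ => #{m₁ ∈ B | m₁ * m₂ ≤ N} with hh
  have hh_anti : Antitone h := by
    intro a b hab
    simp only [hh]
    exact_mod_cast card_le_card (fun m hm => by
      rw [mem_filter] at hm ⊢
      exact ⟨hm.1, le_trans (Nat.mul_le_mul_left _ hab) hm.2⟩)
  have hh0 : ∀ m, 0 ≤ h m := fun m => by positivity
  have hhM : ∀ m, h m ≤ 2 ^ k := by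
    intro m
    calc h m ≤ #B := by simp only [hh]; exact_mod_cast card_filter_le _ _
      _ = 2 ^ k := by rw [hB, card_block]; push_cast; ring
  -- the target count as a sampled sum of `f`
  have hcount : (#{x ∈ blockPairs k N | x.1 % d = r₁ ∧ x.2 % d = r₂} : ℝ) =
      ∑ m₁ ∈ B.filter (fun m => m % d = r₁), f m₁ := by
    rw [blockPairs, filter_filter, card_filter_product_eq_sum, sum_filter]
    push_cast
    refine sum_congr rfl fun m₁ _ => ?_
    by_cases hm : m₁ % d = r₁
    · rw [if_pos hm]; simp only [hf, hm, true_and, hB]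
    · rw [if_neg hm]
      norm_cast
      rw [card_eq_zero, filter_eq_empty_iff]
      exact fun x _ hx => hm hx.2.1
  -- the full sum of `f` as a sampled sum of `h`
  have hsumf : ∑ m₁ ∈ B, f m₁ = ∑ m₂ ∈ B.filter (fun m => m % d = r₂), h m₂ := by
    have h1 : ∑ m₁ ∈ B, f m₁ = (#{x ∈ B ×ˢ B | x.1 * x.2 ≤ N ∧ x.2 % d = r₂} : ℝ) := by
      rw [card_filter_product_eq_sum]; push_cast; rfl
    rw [h1, card_filter_product_eq_sum', sum_filter]
    push_cast
    refine sum_congr rfl fun m₂ _ => ?_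
    by_cases hm : m₂ % d = r₂
    · rw [if_pos hm]; simp only [hh, hm, and_true]
    · rw [if_neg hm]
      norm_cast
      rw [card_eq_zero, filter_eq_empty_iff]
      exact fun x _ hx => hm hx.2
  have hsumh : ∑ m₂ ∈ B, h m₂ = #(blockPairs k N) := by
    rw [blockPairs, card_filter_product_eq_sum']; push_cast; rfl
  -- two applications of the sampling lemma
  have step1 := abs_sum_filter_mod_sub_le hf_anti hf0 hfM hd (2 ^ k) (2 ^ k) hr₁
  have step2 := abs_sum_filter_mod_sub_le hh_anti hh0 hhM hd (2 ^ k) (2 ^ k) hr₂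
  rw [← hBI] at step1 step2
  rw [hcount]
  rw [hsumh] at step2
  have step2' : |(∑ m₁ ∈ B, f m₁) / d - #(blockPairs k N) / (d : ℝ) ^ 2| ≤ 2 * 2 ^ k / d := by
    rw [hsumf, show (#(blockPairs k N) : ℝ) / (d : ℝ) ^ 2 = (#(blockPairs k N) / d) / d by
      rw [sq, div_div], ← sub_div, abs_div, abs_of_pos hd', div_le_div_iff_of_pos_right hd']
    exact step2
  calc |∑ m₁ ∈ B.filter (fun m => m % d = r₁), f m₁ - #(blockPairs k N) / (d : ℝ) ^ 2|
      = |(∑ m₁ ∈ B.filter (fun m => m % d = r₁), f m₁ - (∑ m₁ ∈ B, f m₁) / d) +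
          ((∑ m₁ ∈ B, f m₁) / d - #(blockPairs k N) / (d : ℝ) ^ 2)| := by ring_nf
    _ ≤ |∑ m₁ ∈ B.filter (fun m => m % d = r₁), f m₁ - (∑ m₁ ∈ B, f m₁) / d| +
          |(∑ m₁ ∈ B, f m₁) / d - #(blockPairs k N) / (d : ℝ) ^ 2| := abs_add_le _ _
    _ ≤ 2 * (2 ^ k / d + 1) + 2 * 2 ^ k / d := add_le_add step1 step2'
    _ = 4 * 2 ^ k / d + 2 := by ring

/-! ### The congruence counts `A_d` against `g(d) X` -/

/-- Divisibility of a product by `d` only depends on the residues of the factors. [folklore] -/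
theorem dvd_mul_iff_dvd_mod_mul_mod {d a b : ℕ} : d ∣ a * b ↔ d ∣ a % d * (b % d) := by
  rw [Nat.dvd_iff_mod_eq_zero, Nat.dvd_iff_mod_eq_zero, Nat.mul_mod a b d]

/-- **Residue decomposition**: the pairs with `d ∣ m₁ m₂` split according to the `ρ(d)` pairs of
residues `(r₁, r₂)` with `d ∣ r₁ r₂`. [folklore] -/
theorem card_filter_dvd_eq_sum (S : Finset (ℕ × ℕ)) {d : ℕ} (hd : 0 < d) :
    #{x ∈ S | d ∣ x.1 * x.2} =
      ∑ r ∈ (range d ×ˢ range d).filter (fun r => d ∣ r.1 * r.2),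
        #{x ∈ S | x.1 % d = r.1 ∧ x.2 % d = r.2} := by
  rw [card_eq_sum_card_fiberwise (f := fun x : ℕ × ℕ => (x.1 % d, x.2 % d))
    (s := S.filter (fun x => d ∣ x.1 * x.2))
    (t := (range d ×ˢ range d).filter (fun r => d ∣ r.1 * r.2))]
  · refine sum_congr rfl fun r hr => ?_
    rw [mem_filter] at hr
    rw [filter_filter]
    congr 1
    refine filter_congr fun x _ => ?_
    simp only [Prod.ext_iff]
    constructor
    · rintro ⟨-, h1, h2⟩; exact ⟨h1, h2⟩
    · rintro ⟨h1, h2⟩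
      refine ⟨?_, h1, h2⟩
      rw [dvd_mul_iff_dvd_mod_mul_mod, h1, h2]; exact hr.2
  · intro x hx
    rw [mem_coe, mem_filter] at hx
    rw [mem_coe, mem_filter, mem_product, mem_range, mem_range]
    exact ⟨⟨Nat.mod_lt _ hd, Nat.mod_lt _ hd⟩, dvd_mul_iff_dvd_mod_mul_mod.mp hx.2⟩

/-- The error of `A_d` on one block: `|#{(m₁,m₂) ∈ blockPairs k N : d ∣ m₁ m₂} − ρ(d) #blockPairs/d²|
≤ ρ(d) (4 · 2^k / d + 2)`. [folklore] -/
theorem abs_card_blockPairs_dvd_sub_le (k N : ℕ) {d : ℕ} (hd : 0 < d) :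
    |(#{x ∈ blockPairs k N | d ∣ x.1 * x.2} : ℝ) -
        residueCount d * #(blockPairs k N) / (d : ℝ) ^ 2| ≤
      residueCount d * (4 * 2 ^ k / d + 2) := by
  rw [card_filter_dvd_eq_sum _ hd, residueCount, card_eq_sum_ones, Nat.cast_sum, Nat.cast_sum,
    sum_mul, sum_div, sum_mul, ← sum_sub_distrib]
  refine (abs_sum_le_sum_abs _ _).trans (sum_le_sum fun r hr => ?_)
  rw [mem_filter, mem_product, mem_range, mem_range] at hr
  push_cast
  rw [one_mul, one_mul]
  exact abs_card_blockPairs_mod_sub_le k N hd hr.1.1 hr.1.2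

/-- `#pairSet N = ∑_{k ≤ log₂ N} #blockPairs k N`. [folklore] -/
theorem card_pairSet_eq_sum (N : ℕ) :
    #(pairSet N) = ∑ k ∈ range (Nat.log 2 N + 1), #(blockPairs k N) := by
  have h := card_filter_pairSet N (fun _ => True)
  simp only [filter_true_of_mem (fun _ _ => trivial)] at h
  exact h

/-- **The remainder bound**: for every `d ≥ 1` and `N`,
`|#{(m₁, m₂) ∈ pairSet N : d ∣ m₁ m₂} − ρ(d) #pairSet N / d²| ≤ ρ(d) (8 √N / d + 2 (log₄ N + 1))`
(blocks with `4^k > N` are empty; the others have `2^k ≤ √N`). [folklore] -/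
theorem abs_card_pairSet_dvd_sub_le (N : ℕ) {d : ℕ} (hd : 0 < d) :
    |(#{x ∈ pairSet N | d ∣ x.1 * x.2} : ℝ) - residueCount d * #(pairSet N) / (d : ℝ) ^ 2| ≤
      residueCount d * (8 * Real.sqrt N / d + 2 * (Nat.log 4 N + 1)) := by
  have hd' : (0 : ℝ) < d := by exact_mod_cast hd
  have hρ : (0 : ℝ) ≤ residueCount d := Nat.cast_nonneg _
  rcases Nat.eq_zero_or_pos N with rfl | hN
  · have h0 : pairSet 0 = ∅ := by
      refine eq_empty_of_forall_notMem fun x hx => ?_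
      obtain ⟨⟨h1, h2⟩, -⟩ := mem_pairSet.mp hx
      omega
    simp only [h0, filter_empty, card_empty, Nat.cast_zero, mul_zero, zero_div, sub_zero, abs_zero]
    positivity
  set K := Nat.log 2 N
  set K₂ := Nat.log 4 N
  set D : ℕ → ℝ := fun k => (#{x ∈ blockPairs k N | d ∣ x.1 * x.2} : ℝ) -
    residueCount d * #(blockPairs k N) / (d : ℝ) ^ 2 with hD
  have hdecomp : (#{x ∈ pairSet N | d ∣ x.1 * x.2} : ℝ) -
      residueCount d * #(pairSet N) / (d : ℝ) ^ 2 = ∑ k ∈ range (K + 1), D k := by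
    rw [card_filter_pairSet, card_pairSet_eq_sum, Nat.cast_sum, Nat.cast_sum, mul_sum, sum_div,
      ← sum_sub_distrib]
  rw [hdecomp]
  -- empty blocks contribute nothing
  have hzero : ∀ k, N < 4 ^ k → D k = 0 := by
    intro k hk
    simp only [hD, blockPairs_eq_empty hk, filter_empty, card_empty, Nat.cast_zero, mul_zero,
      zero_div, sub_zero]
  have hbound : ∀ k, |D k| ≤ residueCount d * (4 * 2 ^ k / d + 2) := fun k =>
    abs_card_blockPairs_dvd_sub_le k N hd
  calc |∑ k ∈ range (K + 1), D k| ≤ ∑ k ∈ range (K + 1), |D k| := abs_sum_le_sum_abs _ _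
    _ = ∑ k ∈ (range (K + 1)).filter (fun k => 4 ^ k ≤ N), |D k| := by
        rw [sum_filter]
        refine sum_congr rfl fun k _ => ?_
        by_cases hk : 4 ^ k ≤ N
        · rw [if_pos hk]
        · rw [if_neg hk, hzero k (not_le.mp hk), abs_zero]
    _ ≤ ∑ k ∈ range (K₂ + 1), |D k| := by
        refine sum_le_sum_of_subset_of_nonneg (fun k hk => ?_) fun _ _ _ => abs_nonneg _
        rw [mem_filter] at hk
        exact mem_range.mpr (Nat.lt_succ_of_le (Nat.le_log_of_pow_le (by norm_num) hk.2))
    _ ≤ ∑ k ∈ range (K₂ + 1), (residueCount d : ℝ) * (4 * (2 : ℝ) ^ k / d + 2) :=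
        sum_le_sum fun k _ => hbound k
    _ = residueCount d * (4 / d * ∑ k ∈ range (K₂ + 1), (2 : ℝ) ^ k + 2 * (K₂ + 1)) := by
        rw [← mul_sum, sum_add_distrib, mul_sum, sum_const, card_range, nsmul_eq_mul]
        congr 1
        congr 1
        · exact sum_congr rfl fun k _ => by ring
        · push_cast; ring
    _ ≤ residueCount d * (4 / d * (2 * Real.sqrt N) + 2 * (K₂ + 1)) := by
        gcongr
        -- `∑_{k ≤ K₂} 2^k < 2^{K₂+1} ≤ 2 √N`
        have hgeom : ∑ k ∈ range (K₂ + 1), (2 : ℝ) ^ k = 2 ^ (K₂ + 1) - 1 := by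
          rw [geom_sum_eq (by norm_num)]; norm_num
        have hpow : ((2 : ℝ) ^ K₂) ^ 2 ≤ N := by
          have h4 : (4 : ℕ) ^ K₂ ≤ N := Nat.pow_log_le_self 4 hN.ne'
          calc ((2 : ℝ) ^ K₂) ^ 2 = ((4 : ℕ) ^ K₂ : ℕ) := by
                rw [← pow_mul, mul_comm, pow_mul]; norm_num
            _ ≤ N := by exact_mod_cast h4
        have h2K : (2 : ℝ) ^ K₂ ≤ Real.sqrt N := Real.le_sqrt_of_sq_le hpow
        rw [hgeom, pow_succ]
        linarith
    _ = residueCount d * (8 * Real.sqrt N / d + 2 * (Nat.log 4 N + 1)) := by ring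

/-! ### `ρ(d) ≤ d σ₀(d)` for squarefree `d` -/

/-- `ρ` as an arithmetic function (multiplicative). [folklore] -/
def rho : ArithmeticFunction ℕ := ⟨residueCount, residueCount_zero⟩

/-- `rho d = ρ(d)` (unfolding). [folklore] -/
theorem rho_apply (d : ℕ) : rho d = residueCount d := rfl

/-- `ρ` is multiplicative. [folklore] -/
theorem isMultiplicative_rho : rho.IsMultiplicative :=
  ⟨residueCount_one, fun {_ _} h => residueCount_mul h⟩

/-- For squarefree `d`, `ρ(d) = ∏_{p ∣ d} (2p − 1) ≤ 2^{ω(d)} d = σ₀(d) d`. [folklore] -/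
theorem residueCount_le_of_squarefree {d : ℕ} (hd : Squarefree d) :
    residueCount d ≤ d * ArithmeticFunction.sigma 0 d := by
  have h1 : residueCount d = ∏ p ∈ d.primeFactors, (2 * p - 1) := by
    rw [← rho_apply, ← isMultiplicative_rho.prod_primeFactors hd]
    exact prod_congr rfl fun p hp => by
      rw [rho_apply, residueCount_prime (Nat.prime_of_mem_primeFactors hp)]
  have h2 : ArithmeticFunction.sigma 0 d = ∏ p ∈ d.primeFactors, 2 := by
    rw [← ArithmeticFunction.isMultiplicative_sigma.prod_primeFactors hd]
    refine prod_congr rfl fun p hp => ?_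
    have := ArithmeticFunction.sigma_zero_apply_prime_pow (i := 1) (Nat.prime_of_mem_primeFactors hp)
    rwa [pow_one] at this
  have h3 : ∏ p ∈ d.primeFactors, p = d := Nat.prod_primeFactors_of_squarefree hd
  rw [h1, h2]
  calc ∏ p ∈ d.primeFactors, (2 * p - 1) ≤ ∏ p ∈ d.primeFactors, (p * 2) :=
        prod_le_prod' fun p _ => by omega
    _ = (∏ p ∈ d.primeFactors, p) * ∏ p ∈ d.primeFactors, 2 := prod_mul_distrib
    _ = d * ∏ p ∈ d.primeFactors, 2 := by rw [h3]

/-! ### The sifted sequence of pair products -/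

/-- **The pair-product sequence** `𝒜 = (a_n)`, `a_n = #{(m₁, m₂) : m₁ m₂ = n, m₁, m₂ in a common
dyadic block [2^k, 2^{k+1})}`, with `X(x) = #pairSet ⌊x⌋ = ∑_{n ≤ x} a_n` (the exact mass) and the
multiplicative density `g(d) = ρ(d)/d²` (`g(p) = 2/p − 1/p²`): a sifted sequence of dimension `2`.
[folklore] -/
def pairProducts : SieveSequence where
  a n := weight n
  a_nonneg _ := Nat.cast_nonneg _
  size x := #(pairSet ⌊x⌋₊)
  density := density
  density_mult := isMultiplicative_density

/-- `X(x) = #pairSet ⌊x⌋` (unfolding). [folklore] -/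
theorem pairProducts_size (x : ℝ) : pairProducts.size x = #(pairSet ⌊x⌋₊) := rfl

/-- The density of `pairProducts` is `g = ρ/d²` (unfolding). [folklore] -/
theorem pairProducts_density : pairProducts.density = density := rfl

/-- `S(𝒜, P; x) = #{(m₁, m₂) ∈ pairSet ⌊x⌋ : (m₁ m₂, P) = 1}`. [folklore] -/
theorem pairProducts_sifted (x : ℝ) (P : ℕ) :
    pairProducts.sifted x P = #{p ∈ pairSet ⌊x⌋₊ | (p.1 * p.2).Coprime P} := by
  rw [SieveSequence.sifted]
  exact sum_weight_eq_card ⌊x⌋₊ (fun n => n.Coprime P)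

/-- `A_d(x) = #{(m₁, m₂) ∈ pairSet ⌊x⌋ : d ∣ m₁ m₂}`. [folklore] -/
theorem pairProducts_congrSum (d : ℕ) (x : ℝ) :
    pairProducts.congrSum d x = #{p ∈ pairSet ⌊x⌋₊ | d ∣ p.1 * p.2} := by
  rw [SieveSequence.congrSum]
  exact sum_weight_eq_card ⌊x⌋₊ (fun n => d ∣ n)

/-- `∑_{n ≤ x} a_n = X(x)`: the size is the exact mass. [folklore] -/
theorem pairProducts_sifted_one (x : ℝ) : pairProducts.sifted x 1 = pairProducts.size x := by
  rw [pairProducts_sifted, pairProducts_size, filter_true_of_mem fun p _ => Nat.coprime_one_right _]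

/-- **The remainders of the pair-product sequence**: for `d ≥ 1`,
`|R_d(x)| ≤ ρ(d) (8 √x / d + 2 (log₄ ⌊x⌋ + 1))`. [folklore] -/
theorem abs_remainder_le {d : ℕ} (hd : 0 < d) (x : ℝ) :
    |pairProducts.remainder d x| ≤
      residueCount d * (8 * Real.sqrt x / d + 2 * (Nat.log 4 ⌊x⌋₊ + 1)) := by
  have hd' : (0 : ℝ) < d := by exact_mod_cast hd
  rw [SieveSequence.remainder, pairProducts_congrSum, pairProducts_density, density_apply,
    pairProducts_size, div_mul_eq_mul_div]
  refine (abs_card_pairSet_dvd_sub_le ⌊x⌋₊ hd).trans ?_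
  rcases le_or_gt 0 x with hx | hx
  · gcongr
    exact Nat.floor_le hx
  · rw [Nat.floor_of_nonpos hx.le]
    simp only [Nat.cast_zero, Real.sqrt_zero]
    gcongr
    exact Real.sqrt_nonneg x

/-- `V(P(z)) = ∏_{p < z} (1 − 1/p)²` for the pair-product density. [folklore] -/
theorem pairProducts_densityProduct (z : ℝ) :
    pairProducts.densityProduct (primesProdBelow z) =
      ∏ p ∈ Nat.primesBelow ⌈z⌉₊, (1 - (p : ℝ)⁻¹) ^ 2 := by
  rw [SieveSequence.densityProduct, primeFactors_primesProdBelow, pairProducts_density]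
  refine prod_congr rfl fun p hp => ?_
  rw [density_prime (Nat.prime_of_mem_primesBelow hp)]
  ring

/-! ### The size: `X(x) ≥ x/32` and `X(16^J) ≤ (16^J + 2)/3` -/

/-- `blockPairs k N ⊆ pairSet N`. [folklore] -/
theorem blockPairs_subset_pairSet (k N : ℕ) : blockPairs k N ⊆ pairSet N :=
  fun _ hx => mem_pairSet_iff.mpr ⟨k, hx⟩

/-- `X(x) ≥ x / 32` for `x ≥ 4` (the last full block alone has `4^{K−1} > ⌊x⌋/16` pairs). [folklore] -/
theorem size_ge (x : ℝ) (hx : 4 ≤ x) : x / 32 ≤ pairProducts.size x := by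
  rw [pairProducts_size]
  set N := ⌊x⌋₊ with hN
  have hN4 : 4 ≤ N := Nat.le_floor (by exact_mod_cast hx)
  set K := Nat.log 4 N with hK
  have hK1 : 1 ≤ K := Nat.le_log_of_pow_le (by norm_num) (by simpa using hN4)
  have hfull : blockPairs (K - 1) N = block (K - 1) ×ˢ block (K - 1) :=
    blockPairs_eq_product (by rw [Nat.sub_add_cancel hK1]; exact Nat.pow_log_le_self 4 (by omega))
  have hcard : 4 ^ (K - 1) ≤ #(pairSet N) := by
    calc 4 ^ (K - 1) = #(blockPairs (K - 1) N) := by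
          rw [hfull, card_product, card_block, ← mul_pow]; norm_num
      _ ≤ #(pairSet N) := card_le_card (blockPairs_subset_pairSet _ _)
  have hlt : N < 4 ^ (K + 1) := Nat.lt_pow_succ_log_self (by norm_num) N
  have h16 : 4 ^ (K + 1) = 16 * 4 ^ (K - 1) := by
    rw [show K + 1 = (K - 1) + 2 by omega, pow_add]; ring
  have hxN : x < N + 1 := Nat.lt_floor_add_one x
  have h1 : (N : ℝ) < 16 * (4 : ℝ) ^ (K - 1) := by exact_mod_cast h16 ▸ hlt
  have h2 : ((4 : ℕ) ^ (K - 1) : ℝ) ≤ #(pairSet N) := by exact_mod_cast hcard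
  push_cast at h2
  have h3 : (1 : ℝ) ≤ (4 : ℝ) ^ (K - 1) := one_le_pow₀ (by norm_num)
  linarith

/-- In the block `B_{2J}` only the pair `(4^J, 4^J)` has product `≤ 16^J`. [folklore] -/
theorem card_blockPairs_two_mul_le_one (J : ℕ) : #(blockPairs (2 * J) (16 ^ J)) ≤ 1 := by
  refine card_le_one.mpr fun x hx y hy => ?_
  have h4 : (2 : ℕ) ^ (2 * J) = 4 ^ J := by rw [pow_mul]; norm_num
  have h16 : (16 : ℕ) ^ J = 4 ^ J * 4 ^ J := by rw [← mul_pow]; norm_num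
  have key : ∀ w ∈ blockPairs (2 * J) (16 ^ J), w = (4 ^ J, 4 ^ J) := by
    intro w hw
    obtain ⟨h1, h2, h3⟩ := mem_blockPairs.mp hw
    have h1' := (mem_block.mp h1).1
    have h2' := (mem_block.mp h2).1
    rw [h4] at h1' h2'
    rw [h16] at h3
    have hp : 0 < 4 ^ J := Nat.pos_of_ne_zero (by positivity)
    have e1 : w.1 ≤ 4 ^ J := by
      by_contra hc
      have : 4 ^ J * 4 ^ J < w.1 * w.2 :=
        Nat.mul_lt_mul_of_lt_of_le (not_le.mp hc) h2' (lt_of_lt_of_le hp h2')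
      omega
    have e2 : w.2 ≤ 4 ^ J := by
      by_contra hc
      have : 4 ^ J * 4 ^ J < w.1 * w.2 :=
        Nat.mul_lt_mul_of_le_of_lt h1' (not_le.mp hc) (lt_of_lt_of_le hp h1')
      omega
    exact Prod.ext (le_antisymm e1 h1') (le_antisymm e2 h2')
  rw [key x hx, key y hy]

/-- **`X(16^J) ≤ (16^J + 2)/3`**: the blocks `k < 2J` contribute at most `4^k` each, the block
`2J` one pair, the higher blocks nothing. [folklore] -/
theorem size_sixteen_pow_le (J : ℕ) :
    pairProducts.size ((16 : ℝ) ^ J) ≤ ((16 : ℝ) ^ J + 2) / 3 := by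
  rw [pairProducts_size, show ((16 : ℝ) ^ J) = ((16 ^ J : ℕ) : ℝ) by push_cast; ring,
    Nat.floor_natCast, card_pairSet_eq_sum]
  set K := Nat.log 2 (16 ^ J)
  have hterm : ∀ k, (#(blockPairs k (16 ^ J)) : ℝ) ≤
      (if k < 2 * J then (4 : ℝ) ^ k else 0) + (if k = 2 * J then 1 else 0) := by
    intro k
    rcases lt_trichotomy k (2 * J) with hk | hk | hk
    · rw [if_pos hk, if_neg hk.ne, add_zero]
      exact_mod_cast card_blockPairs_le k _
    · rw [if_neg hk.not_lt, if_pos hk, zero_add, hk]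
      exact_mod_cast card_blockPairs_two_mul_le_one J
    · rw [if_neg (by omega), if_neg (by omega), add_zero]
      have : blockPairs k (16 ^ J) = ∅ := blockPairs_eq_empty (by
        calc 16 ^ J = 4 ^ (2 * J) := by rw [pow_mul]; norm_num
          _ < 4 ^ k := Nat.pow_lt_pow_right (by norm_num) hk)
      rw [this, card_empty, Nat.cast_zero]
  push_cast
  calc ∑ k ∈ range (K + 1), (#(blockPairs k (16 ^ J)) : ℝ)
      ≤ ∑ k ∈ range (K + 1), ((if k < 2 * J then (4 : ℝ) ^ k else 0) +
          (if k = 2 * J then 1 else 0)) := sum_le_sum fun k _ => hterm k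
    _ = ∑ k ∈ (range (K + 1)).filter (· < 2 * J), (4 : ℝ) ^ k +
          ∑ k ∈ range (K + 1), (if k = 2 * J then (1 : ℝ) else 0) := by
        rw [sum_add_distrib, sum_filter]
    _ ≤ ∑ k ∈ range (2 * J), (4 : ℝ) ^ k + 1 := by
        gcongr with k hk
        · intro k hk
          rw [mem_filter] at hk
          exact mem_range.mpr hk.2
        · rw [sum_ite_eq']
          split_ifs <;> norm_num
    _ = ((16 : ℝ) ^ J + 2) / 3 := by
        rw [geom_sum_eq (by norm_num), pow_mul]
        norm_num
        ring

/-! ### The sifted sum at `x = 16^J`, `z = 2^J`: pairs of primes in the blocks `J ≤ k < 2J` -/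

/-- **Lower bound for the sifted sum by prime pairs**: for `x = 16^J` and `z = 2^J`,
`S(𝒜, z; x) ≥ ∑_{J ≤ k < 2J} (#{p ∈ B_k prime})²`: a pair of primes in a common block `B_k`,
`J ≤ k < 2J`, has product `< 4^{k+1} ≤ 16^J` and no prime factor `< 2^J`. [folklore] -/
theorem sum_sq_card_primes_le_sifted (J : ℕ) :
    ∑ k ∈ Ico J (2 * J), ((#((block k).filter Nat.Prime) : ℝ)) ^ 2 ≤
      pairProducts.sifted ((16 : ℝ) ^ J) (primesProdBelow ((2 : ℝ) ^ J)) := by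
  rw [pairProducts_sifted, show ((16 : ℝ) ^ J) = ((16 ^ J : ℕ) : ℝ) by push_cast; ring,
    Nat.floor_natCast]
  set T := {p ∈ pairSet (16 ^ J) | (p.1 * p.2).Coprime (primesProdBelow ((2 : ℝ) ^ J))}
  set U : ℕ → Finset (ℕ × ℕ) := fun k => (block k).filter Nat.Prime ×ˢ (block k).filter Nat.Prime
  have hsub : (Ico J (2 * J)).biUnion U ⊆ T := by
    intro x hx
    rw [mem_biUnion] at hx
    obtain ⟨k, hk, hxk⟩ := hx
    rw [mem_Ico] at hk
    simp only [U, mem_product, mem_filter] at hxk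
    obtain ⟨⟨h1, hp1⟩, ⟨h2, hp2⟩⟩ := hxk
    rw [mem_filter]
    constructor
    · refine blockPairs_subset_pairSet k _ ?_
      rw [blockPairs_eq_product]
      · exact mem_product.mpr ⟨h1, h2⟩
      · calc 4 ^ (k + 1) ≤ 4 ^ (2 * J) := Nat.pow_le_pow_right (by norm_num) (by omega)
          _ = 16 ^ J := by rw [pow_mul]; norm_num
    · rw [coprime_primesProdBelow_iff]
      intro q hq hdvd
      rw [Nat.mem_primesBelow] at hq
      have hq2 : (q : ℝ) < (2 : ℝ) ^ J := Nat.lt_ceil.mp hq.1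
      have hqJ : q < 2 ^ J := by exact_mod_cast hq2
      have hge : ∀ m ∈ block k, 2 ^ J ≤ m := fun m hm =>
        le_trans (Nat.pow_le_pow_right (by norm_num) hk.1) (mem_block.mp hm).1
      rcases (Nat.Prime.dvd_mul hq.2).mp hdvd with h | h
      · have := (Nat.prime_dvd_prime_iff_eq hq.2 hp1).mp h
        have := hge _ h1; omega
      · have := (Nat.prime_dvd_prime_iff_eq hq.2 hp2).mp h
        have := hge _ h2; omega
  have hdisj : ((Ico J (2 * J)) : Set ℕ).PairwiseDisjoint U := by
    intro k _ l _ hkl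
    simp only [U, Function.onFun]
    rw [disjoint_left]
    rintro x hxk hxl
    simp only [mem_product, mem_filter] at hxk hxl
    have e1 := (mem_block_iff_log.mp hxk.1.1).2
    have e2 := (mem_block_iff_log.mp hxl.1.1).2
    exact hkl (e1.symm.trans e2)
  calc ∑ k ∈ Ico J (2 * J), ((#((block k).filter Nat.Prime) : ℝ)) ^ 2
      = ∑ k ∈ Ico J (2 * J), (#(U k) : ℝ) := by
        refine sum_congr rfl fun k _ => ?_
        simp only [U, card_product]; push_cast; ring
    _ = #((Ico J (2 * J)).biUnion U) := by rw [card_biUnion hdisj]; push_cast; rfl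
    _ ≤ #T := by exact_mod_cast card_le_card hsub

/-! ### Level of distribution `1/2` -/

/-- `log₄ ⌊x⌋ ≤ log x` for `x ≥ 1` (`log 4 ≥ 1`). [folklore] -/
theorem natLog_four_floor_le_log {x : ℝ} (hx : 1 ≤ x) : (Nat.log 4 ⌊x⌋₊ : ℝ) ≤ Real.log x := by
  set N := ⌊x⌋₊ with hN
  rcases Nat.eq_zero_or_pos (Nat.log 4 N) with h0 | hpos
  · rw [h0, Nat.cast_zero]; exact Real.log_nonneg hx
  have hN0 : N ≠ 0 := by
    intro h; rw [h, Nat.log_zero_right] at hpos; exact lt_irrefl 0 hpos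
  have h1 : ((4 : ℕ) ^ Nat.log 4 N : ℝ) ≤ N := by exact_mod_cast Nat.pow_log_le_self 4 hN0
  have hNx : (N : ℝ) ≤ x := Nat.floor_le (by linarith)
  have h2 : (Nat.log 4 N : ℝ) * Real.log 4 ≤ Real.log x := by
    rw [← Real.log_pow]
    push_cast at h1
    exact Real.log_le_log (by positivity) (h1.trans hNx)
  have hlog4 : 1 ≤ Real.log 4 := by
    rw [← Real.log_exp 1]
    exact Real.log_le_log (Real.exp_pos 1) (by linarith [Real.exp_one_lt_three])
  nlinarith

/-- **The level-of-distribution sum, pointwise**: with the divisor bound `σ₀(n) ≤ C n^ε`,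
for `x ≥ 1`, `∑_{d ≤ x^{1/2−ε}, d squarefree} |R_d(x)| ≤ C x^{1−ε/2} (2 log x + 10)`. [folklore] -/
theorem sum_abs_remainder_le {ε : ℝ} (hε : 0 < ε) {C : ℝ} (hC0 : 0 ≤ C)
    (hC : ∀ n : ℕ, ((ArithmeticFunction.sigma 0 n : ℕ) : ℝ) ≤ C * (n : ℝ) ^ ε) {x : ℝ}
    (hx : 1 ≤ x) :
    ∑ d ∈ (Icc 1 ⌊x ^ (1 / 2 - ε)⌋₊).filter Squarefree, |pairProducts.remainder d x| ≤
      C * x ^ (1 - ε / 2) * (2 * Real.log x + 10) := by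
  have hx0 : 0 < x := by linarith
  have hlog : 0 ≤ Real.log x := Real.log_nonneg hx
  set D := ⌊x ^ (1 / 2 - ε)⌋₊ with hD
  have hDx : (D : ℝ) ≤ x ^ (1 / 2 - ε) := Nat.floor_le (Real.rpow_nonneg hx0.le _)
  have hxhalf : x ^ (1 / 2 - ε) ≤ x ^ (1 / 2 : ℝ) :=
    Real.rpow_le_rpow_of_exponent_le hx (by linarith)
  have hsqrt : Real.sqrt x = x ^ (1 / 2 : ℝ) := Real.sqrt_eq_rpow x
  -- the bound for a single `d`
  set M : ℝ := x ^ (1 / 2 : ℝ) * (2 * Real.log x + 10) with hM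
  have hM0 : 0 ≤ M := by positivity
  have hterm : ∀ d ∈ (Icc 1 D).filter Squarefree,
      |pairProducts.remainder d x| ≤ C * (x ^ (1 / 2 - ε)) ^ ε * M := by
    intro d hd
    rw [mem_filter, mem_Icc] at hd
    obtain ⟨⟨hd1, hdD⟩, hsq⟩ := hd
    have hd0 : (0 : ℝ) < d := by exact_mod_cast hd1
    have hdx : (d : ℝ) ≤ x ^ (1 / 2 - ε) := le_trans (by exact_mod_cast hdD) hDx
    have hρ : (residueCount d : ℝ) ≤ d * (ArithmeticFunction.sigma 0 d : ℕ) := by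
      exact_mod_cast residueCount_le_of_squarefree hsq
    have hσ := hC d
    have hdε : (d : ℝ) ^ ε ≤ (x ^ (1 / 2 - ε)) ^ ε := Real.rpow_le_rpow hd0.le hdx hε.le
    have hL : (Nat.log 4 ⌊x⌋₊ : ℝ) ≤ Real.log x := natLog_four_floor_le_log hx
    have hσ0 : (0 : ℝ) ≤ (ArithmeticFunction.sigma 0 d : ℕ) := Nat.cast_nonneg _
    calc |pairProducts.remainder d x|
        ≤ residueCount d * (8 * Real.sqrt x / d + 2 * (Nat.log 4 ⌊x⌋₊ + 1)) :=
          abs_remainder_le hd1 x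
      _ ≤ (d * (ArithmeticFunction.sigma 0 d : ℕ)) *
            (8 * x ^ (1 / 2 : ℝ) / d + 2 * (Real.log x + 1)) := by
          rw [hsqrt]
          refine mul_le_mul hρ (by linarith) (by positivity) (by positivity)
      _ = (ArithmeticFunction.sigma 0 d : ℕ) * (8 * x ^ (1 / 2 : ℝ) + 2 * (Real.log x + 1) * d) := by
          field_simp
      _ ≤ (C * (d : ℝ) ^ ε) * (8 * x ^ (1 / 2 : ℝ) + 2 * (Real.log x + 1) * x ^ (1 / 2 : ℝ)) := by
          refine mul_le_mul hσ (by nlinarith [hdx.trans hxhalf]) (by positivity) (by positivity)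
      _ = C * (d : ℝ) ^ ε * M := by rw [hM]; ring
      _ ≤ C * (x ^ (1 / 2 - ε)) ^ ε * M := by gcongr
  have hcardD : (#((Icc 1 D).filter Squarefree) : ℝ) ≤ D := by
    calc (#((Icc 1 D).filter Squarefree) : ℝ) ≤ #(Icc 1 D) := by
          exact_mod_cast card_filter_le _ _
      _ = D := by rw [Nat.card_Icc]; push_cast; ring
  have hK0 : 0 ≤ C * (x ^ (1 / 2 - ε)) ^ ε * M := by positivity
  calc ∑ d ∈ (Icc 1 D).filter Squarefree, |pairProducts.remainder d x|
      ≤ ∑ d ∈ (Icc 1 D).filter Squarefree, C * (x ^ (1 / 2 - ε)) ^ ε * M := sum_le_sum hterm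
    _ = #((Icc 1 D).filter Squarefree) * (C * (x ^ (1 / 2 - ε)) ^ ε * M) := by
        rw [sum_const, nsmul_eq_mul]
    _ ≤ D * (C * (x ^ (1 / 2 - ε)) ^ ε * M) := mul_le_mul_of_nonneg_right hcardD hK0
    _ ≤ x ^ (1 / 2 - ε) * (C * (x ^ (1 / 2 - ε)) ^ ε * M) := mul_le_mul_of_nonneg_right hDx hK0
    _ = C * (x ^ (1 / 2 - ε) * (x ^ (1 / 2 - ε)) ^ ε * x ^ (1 / 2 : ℝ)) * (2 * Real.log x + 10) := by
        rw [hM]; ring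
    _ = C * x ^ (1 - ε / 2 - ε ^ 2) * (2 * Real.log x + 10) := by
        congr 2
        rw [← Real.rpow_mul hx0.le, ← Real.rpow_add hx0, ← Real.rpow_add hx0]
        ring_nf
    _ ≤ C * x ^ (1 - ε / 2) * (2 * Real.log x + 10) := by
        refine mul_le_mul_of_nonneg_right (mul_le_mul_of_nonneg_left ?_ hC0) (by positivity)
        exact Real.rpow_le_rpow_of_exponent_le hx (by nlinarith)

/-- **The pair-product sequence has level of distribution `1/2`**:
`∑_{d ≤ x^{1/2−ε}, d squarefree} |R_d(x)| ≪ x^{1−ε/2} log x = o(X(x)/(log x)^B)` for every `B`,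
since `X(x) ≥ x/32`. [folklore] -/
theorem hasLevelOfDistribution_pairProducts : HasLevelOfDistribution pairProducts (1 / 2) := by
  intro ε hε B hB
  obtain ⟨C, hC1, hC⟩ := exists_sigma_zero_le_mul_rpow hε
  have hC0 : 0 ≤ C := by linarith
  -- `(log x)^{B+1} = o(x^{ε/2})`
  have hlo := isLittleO_log_rpow_rpow_atTop (B + 1) (half_pos hε)
  have hc : (0 : ℝ) < 1 / (96 * C) := by positivity
  have hev := hlo.def hc
  refine Asymptotics.IsBigO.of_bound 1 ?_
  filter_upwards [hev, Filter.eventually_ge_atTop (Real.exp 10)] with x hx hx10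
  have hx1 : 1 ≤ x := le_trans (by linarith [Real.add_one_le_exp (10 : ℝ)]) hx10
  have hx0 : 0 < x := by linarith
  have hx4 : 4 ≤ x := le_trans (by linarith [Real.add_one_le_exp (10 : ℝ)]) hx10
  have hlog10 : 10 ≤ Real.log x := by
    rw [← Real.log_exp 10]; exact Real.log_le_log (Real.exp_pos _) hx10
  have hlog0 : 0 < Real.log x := by linarith
  rw [one_mul, Real.norm_eq_abs, Real.norm_eq_abs,
    abs_of_nonneg (sum_nonneg fun d _ => abs_nonneg _)]
  refine (sum_abs_remainder_le hε hC0 hC hx1).trans ?_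
  -- compare with `X(x)/(log x)^B ≥ (x/32)/(log x)^B`
  have hsize := size_ge x hx4
  have hlogB : 0 < Real.log x ^ B := Real.rpow_pos_of_pos hlog0 B
  rw [abs_of_nonneg (div_nonneg (by linarith) hlogB.le), le_div_iff₀ hlogB]
  -- from the little-o bound: `(log x)^{B+1} ≤ x^{ε/2} / (96 C)`
  rw [Real.norm_eq_abs, Real.norm_eq_abs, abs_of_nonneg (Real.rpow_nonneg hlog0.le _),
    abs_of_nonneg (Real.rpow_nonneg hx0.le _), Real.rpow_add_one hlog0.ne'] at hx
  have h1 : 2 * Real.log x + 10 ≤ 3 * Real.log x := by linarith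
  have key : C * x ^ (1 - ε / 2) * (2 * Real.log x + 10) * Real.log x ^ B ≤ x / 32 := by
    calc C * x ^ (1 - ε / 2) * (2 * Real.log x + 10) * Real.log x ^ B
        ≤ C * x ^ (1 - ε / 2) * (3 * Real.log x) * Real.log x ^ B := by gcongr
      _ = 3 * C * x ^ (1 - ε / 2) * (Real.log x ^ B * Real.log x) := by ring
      _ ≤ 3 * C * x ^ (1 - ε / 2) * (1 / (96 * C) * x ^ (ε / 2)) := by gcongr
      _ = x ^ (1 - ε / 2) * x ^ (ε / 2) / 32 := by field_simp; ring
      _ = x / 32 := by rw [← Real.rpow_add hx0]; norm_num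
  linarith

end PairProducts

end Literature.NumberTheory.Sieve
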